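import Literature.AnabelianGeometry.EtaleTheta.ThetaSystems
import Literature.AnabelianGeometry.EtaleTheta.Discharge.Sec2CyclotomicRigidityProofs
import Mathlib.Data.Finite.Prod

/-!
# [EtTh] §2 discharge: lemmas towards Corollary 2.19 (ii) (discrete rigidity) —
# isomorphisms of model mono-theta environments, reductions `M_{M'} → M_M`, finiteness of the
# automorphisms over `id_{Π^tp_Y}` (proof-only companion of `MonoThetaEnv.lean` / `ThetaSystems.lean`)

Mochizuki, *The Étale Theta Function and its Frobenioid-theoretic Manifestations* [EtTh],
Publ. RIMS 45 (2009), §2, Def 2.13 (ii) pp.47–48, Cor 2.18 (iv) pp.61–63, Cor 2.19 (ii) p.64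
(locators `p.N` = PDF pages of the PRIMS text; bib key `MochizukiEtTh2009`).
PROOF-ONLY companion (no `def`, no new named fact; seat abc-iut-L2-d1, DAG node `EtTh:Cor2.19(ii)`,
LONG-CHAINS lane C2) of `MonoThetaEnv.lean`, `ThetaSystems.lean` (seat abc-iut-L2-t2; nothing
there is edited or restated). Pure group theory / topology:

* `ThetaEnvData.isTopologicalGroup_env` — `Π^tp_Y[μ_N] = μ_N ⋊ Π^tp_Y` IS a topological group
  (the action of `Π^tp_Y` on `μ_N` has open kernel, `ThetaEnvData.chi_ker_open`);
* isomorphisms of model mono-theta environments compose, invert, and contain the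
  `μ_N`-conjugations (Def 2.13 (ii)) — stated as EXISTENCE theorems (`exists_iso_symm`,
  `exists_iso_trans`, `exists_iso_conj_inMu`), since a proof-only file defines no data;
* `ThetaEnvData.continuousMulEquiv_PiX_unique` — the automorphism of `Π^tp_X` under an
  automorphism of `M(η)` (`Discharge/Sec2IsoLift.lean`) is UNIQUE (temp-slimness);
* `ThetaEnvData.finite_autOverId` — given the fibre description of Cor 2.18 (iv) ("the kernel
  … is naturally isomorphic to `Hom(Π•_Y/Π•_Ÿ, Ker(Π• ↠ Π•_Y))`", p.63, up to `μ_N`-conjugacy), the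
  automorphisms of `M(η)` inducing the identity on `Π^tp_Y` form a FINITE set — the finiteness
  behind "the `R¹lim`'s … vanish" in the proof of Cor 2.19 (ii) (p.66);
* `ThetaEnvTower.*` — the reductions `Π^tp_Y[μ_{M'}] ↠ Π^tp_Y[μ_M]` (Def 2.13 (ii) "`M_{N'}`") are
  surjective, transitive, the identity for `M = M'`, and the relation `Reduces` (Cor 2.18 (iv)) is
  functional and multiplicative.

HONEST FRAMING: no side is taken on [IUTchIII] Cor 3.12; typed ≠ discharged elsewhere.
-/

namespace Literature.AnabelianGeometry.EtaleTheta

universe u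

namespace ThetaEnvData

variable {N : ℕ+} (T : ThetaEnvData.{u} N)

/-! ## `Π^tp_Y[μ_N]` is a topological group -/

/-- `h ↦ χ(h)·a` is continuous on `Π^tp_Y` (the action has open kernel).
[cite: MochizukiEtTh2009, Def 2.13(ii) p.47] -/
theorem continuous_chi_augY_apply (a : T.mu) : Continuous fun h : T.PiY => T.chi (T.augY h) a := by
  have hK : IsOpen ((((T.chi.comp T.aug).ker).comap T.PiY.subtype : Subgroup T.PiY) : Set T.PiY) :=
    T.chi_ker_open.preimage continuous_subtype_val
  rw [continuous_def]
  intro s _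
  rw [isOpen_iff_forall_mem_open]
  intro h hh
  refine ⟨(fun k => h * k) '' (((T.chi.comp T.aug).ker).comap T.PiY.subtype : Subgroup T.PiY),
    ?_, (isOpenMap_mul_left h) _ hK, ⟨1, Subgroup.one_mem _, mul_one h⟩⟩
  rintro _ ⟨k, hk, rfl⟩
  have hk' : T.chi (T.aug (k : T.PiX)) = 1 := hk
  change T.chi (T.aug ((h * k : T.PiY) : T.PiX)) a ∈ s
  rw [Subgroup.coe_mul, map_mul, map_mul, hk', mul_one]
  exact hh

/-- `(a, h) ↦ χ(h)·a` is jointly continuous (`μ_N` discrete).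
[cite: MochizukiEtTh2009, Def 2.13(ii) p.47] -/
theorem continuous_chi_augY_uncurry :
    Continuous fun q : T.mu × T.PiY => T.chi (T.augY q.2) q.1 := by
  rw [continuous_discrete_rng]
  intro b
  have : (fun q : T.mu × T.PiY => T.chi (T.augY q.2) q.1) ⁻¹' {b} =
      ⋃ a : T.mu, ({a} : Set T.mu) ×ˢ ((fun h : T.PiY => T.chi (T.augY h) a) ⁻¹' {b}) := by
    ext ⟨a, h⟩
    simp
  rw [this]
  exact isOpen_iUnion fun a =>
    (isOpen_discrete _).prod ((isOpen_discrete _).preimage (T.continuous_chi_augY_apply a))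

/-- **`Π^tp_Y[μ_N] = μ_N ⋊ Π^tp_Y` is a topological group** (`μ_N` discrete, the action of
`Π^tp_Y` on `μ_N` continuous). [cite: MochizukiEtTh2009, Def 2.13(ii) p.47] -/
theorem isTopologicalGroup_env : IsTopologicalGroup T.env := by
  have hmul : Continuous fun p : T.env × T.env => p.1 * p.2 := by
    change Continuous fun p : T.env × T.env =>
      (⟨p.1.left * T.chi (T.augY p.1.right) p.2.left, p.1.right * p.2.right⟩ : T.env)
    refine T.continuous_env_mk ?_ ?_
    · refine (T.continuous_left.comp continuous_fst).mul ?_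
      exact T.continuous_chi_augY_uncurry.comp ((T.continuous_left.comp continuous_snd).prodMk
        (T.continuous_right.comp continuous_fst))
    · exact (T.continuous_right.comp continuous_fst).mul (T.continuous_right.comp continuous_snd)
  have hinv : Continuous fun x : T.env => x⁻¹ := by
    change Continuous fun x : T.env => (⟨T.chi (T.augY x.right⁻¹) x.left⁻¹, x.right⁻¹⟩ : T.env)
    refine T.continuous_env_mk ?_ (T.continuous_right.inv)
    exact T.continuous_chi_augY_uncurry.comp
      ((continuous_of_discreteTopology.comp T.continuous_left).prodMk T.continuous_right.inv)
  exact { continuous_mul := hmul, continuous_inv := hinv }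

/-- `μ_N`-conjugation is an automorphism of the topological group `Π^tp_Y[μ_N]`.
[cite: MochizukiEtTh2009, Def 2.13(ii) p.47] -/
theorem conj_inMu_mem_contMulAut (c : T.mu) :
    MulAut.conj (CycEnvelope.inMu T.augY T.chi c) ∈ contMulAut T.env := by
  haveI := T.isTopologicalGroup_env
  exact innerAut_le_contMulAut T.env ⟨_, rfl⟩

/-! ## Isomorphisms of model mono-theta environments: inverse, composite, `μ_N`-conjugations -/

/-- Transport along a composite. [cite: MochizukiEtTh2009, Def 2.13(ii) p.47] -/
theorem transport_trans {A B C : Type*} [Group A] [Group B] [Group C] [TopologicalSpace A]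
    [TopologicalSpace B] [TopologicalSpace C] (e : A ≃ₜ* B) (f : B ≃ₜ* C) (d : TopOut A) :
    TopOut.transport (e.trans f) d = TopOut.transport f (TopOut.transport e d) := by
  obtain ⟨φ, rfl⟩ := QuotientGroup.mk'_surjective _ d
  rfl

variable {T}
variable {η η' η'' : T.PiYdd → T.mu} {hη : η ∈ T.thetaCocycles} {hη' : η' ∈ T.thetaCocycles}
  {hη'' : η'' ∈ T.thetaCocycles}

/-- The inverse of an isomorphism of model mono-theta environments is one.
[cite: MochizukiEtTh2009, Def 2.13(ii) p.48] -/
theorem exists_iso_symm (α : (T.modelMono hη).Iso (T.modelMono hη')) :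
    ∃ β : (T.modelMono hη').Iso (T.modelMono hη), ∀ x, β.e x = α.e.symm x := by
  refine ⟨{ e := α.e.symm, map_D := T.iso_map_D_symm α, map_sTheta := ?_ }, fun x => rfl⟩
  have h := α.map_sTheta
  change (fun H : Subgroup T.env => H.map α.e.symm.toMulEquiv.toMonoidHom) ''
      CycEnvelope.muConjClass T.augY T.chi (T.sTheta hη').range =
    CycEnvelope.muConjClass T.augY T.chi (T.sTheta hη).range
  change (fun H : Subgroup T.env => H.map α.e.toMulEquiv.toMonoidHom) ''
      CycEnvelope.muConjClass T.augY T.chi (T.sTheta hη).range =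
    CycEnvelope.muConjClass T.augY T.chi (T.sTheta hη').range at h
  rw [← h, Set.image_image]
  have hc : α.e.symm.toMulEquiv.toMonoidHom.comp α.e.toMulEquiv.toMonoidHom = MonoidHom.id _ :=
    MonoidHom.ext fun x => α.e.symm_apply_apply x
  refine (Set.image_congr' fun H => ?_).trans (Set.image_id _)
  change (H.map _).map _ = H
  rw [Subgroup.map_map, hc, Subgroup.map_id]

/-- The composite of isomorphisms of model mono-theta environments is one.
[cite: MochizukiEtTh2009, Def 2.13(ii) p.48] -/
theorem exists_iso_trans (α : (T.modelMono hη).Iso (T.modelMono hη'))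
    (β : (T.modelMono hη').Iso (T.modelMono hη'')) :
    ∃ δ : (T.modelMono hη).Iso (T.modelMono hη''), ∀ x, δ.e x = β.e (α.e x) := by
  refine ⟨{ e := α.e.trans β.e, map_D := ?_, map_sTheta := ?_ }, fun x => rfl⟩
  · have hα := α.map_D
    have hβ := β.map_D
    change T.DY.map (TopOut.transport α.e) = T.DY at hα
    change T.DY.map (TopOut.transport β.e) = T.DY at hβ
    change T.DY.map (TopOut.transport (α.e.trans β.e)) = T.DY
    have : TopOut.transport (α.e.trans β.e) = (TopOut.transport β.e).comp (TopOut.transport α.e) :=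
      MonoidHom.ext fun d => transport_trans α.e β.e d
    rw [this, ← Subgroup.map_map, hα, hβ]
  · have hα := α.map_sTheta
    have hβ := β.map_sTheta
    change (fun H : Subgroup T.env => H.map α.e.toMulEquiv.toMonoidHom) ''
        CycEnvelope.muConjClass T.augY T.chi (T.sTheta hη).range =
      CycEnvelope.muConjClass T.augY T.chi (T.sTheta hη').range at hα
    change (fun H : Subgroup T.env => H.map β.e.toMulEquiv.toMonoidHom) ''
        CycEnvelope.muConjClass T.augY T.chi (T.sTheta hη').range =
      CycEnvelope.muConjClass T.augY T.chi (T.sTheta hη'').range at hβ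
    change (fun H : Subgroup T.env => H.map (α.e.trans β.e).toMulEquiv.toMonoidHom) ''
        CycEnvelope.muConjClass T.augY T.chi (T.sTheta hη).range =
      CycEnvelope.muConjClass T.augY T.chi (T.sTheta hη'').range
    rw [← hβ, ← hα, Set.image_image]
    refine Set.image_congr' fun H => ?_
    rw [Subgroup.map_map]
    rfl

/-- The `μ_N`-conjugations are automorphisms of the model `M(η)` (they are trivial in `Out`, fix
`μ_N` and permute the `μ_N`-conjugacy class of `Im s^Θ`). [cite: MochizukiEtTh2009, Def 2.13(ii) p.47] -/
theorem exists_iso_conj_inMu (hη : η ∈ T.thetaCocycles) (c : T.mu) :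
    ∃ β : (T.modelMono hη).Iso (T.modelMono hη),
      ∀ x, β.e x = MulAut.conj (CycEnvelope.inMu T.augY T.chi c) x := by
  let κ : contMulAut T.env := ⟨_, T.conj_inMu_mem_contMulAut c⟩
  have hκ : TopOut.mk _ κ = 1 :=
    (QuotientGroup.eq_one_iff _).mpr (Subgroup.mem_subgroupOf.mpr ⟨_, rfl⟩)
  let e0 : T.env ≃ₜ* T.env := ContinuousMulEquiv.mk (κ : MulAut T.env) κ.2.1 κ.2.2
  refine ⟨{ e := e0, map_D := ?_, map_sTheta := ?_ }, fun x => rfl⟩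
  · change T.DY.map (TopOut.transport e0) = T.DY
    have ht : TopOut.transport e0 = MonoidHom.id _ := by
      refine MonoidHom.ext fun d => ?_
      obtain ⟨φ, rfl⟩ := QuotientGroup.mk'_surjective _ d
      change TopOut.transport e0 (TopOut.mk _ φ) = TopOut.mk _ φ
      rw [transport_mk]
      have : conjContAut e0 φ = κ * φ * κ⁻¹ := Subtype.ext (MulEquiv.ext fun x => rfl)
      rw [this, map_mul, map_mul, map_inv, hκ, one_mul, inv_one, mul_one]
    rw [ht, Subgroup.map_id]
  · change (fun H : Subgroup T.env =>
        H.map (MulAut.conj (CycEnvelope.inMu T.augY T.chi c)).toMonoidHom) ''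
        CycEnvelope.muConjClass T.augY T.chi (T.sTheta hη).range =
      CycEnvelope.muConjClass T.augY T.chi (T.sTheta hη).range
    rw [CycEnvelope.image_muConjClass_eq T.augY T.chi _ (fun a => by
      rw [MulAut.conj_apply, ← map_mul, ← map_inv, ← map_mul, mul_inv_cancel_comm])]
    ext K
    constructor
    · rintro ⟨a, rfl⟩
      refine ⟨a * c, ?_⟩
      rw [Subgroup.map_map]
      congr 1
      refine MonoidHom.ext fun x => ?_
      simp only [MonoidHom.coe_comp, Function.comp_apply, MulEquiv.coe_toMonoidHom,
        MulAut.conj_apply]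
      simp only [map_mul]
      group
    · rintro ⟨a, rfl⟩
      refine ⟨a * c⁻¹, ?_⟩
      rw [Subgroup.map_map]
      congr 1
      refine MonoidHom.ext fun x => ?_
      simp only [MonoidHom.coe_comp, Function.comp_apply, MulEquiv.coe_toMonoidHom,
        MulAut.conj_apply]
      simp only [map_mul, map_inv]
      group

/-! ## Uniqueness of the automorphism of `Π^tp_X` under an automorphism of `Π^tp_Y[μ_N]` -/

/-- Two automorphisms of `Π^tp_X` lying under the same automorphism `e` of `Π^tp_Y[μ_N]` coincide
(faithfulness of the conjugation action on `Π^tp_Y`, `RigidData.Cor218_iii_PiX`).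
[cite: MochizukiEtTh2009, Cor 2.18(iii) p.61] -/
theorem continuousMulEquiv_PiX_unique
    (hslim : ∀ x : T.PiX, (∀ h : T.PiY, x * h * x⁻¹ = h) → x = 1) (e : T.env ≃* T.env)
    (γ₁ γ₂ : T.PiX ≃ₜ* T.PiX) (h₁ : ∀ x : T.env, ((e x).right : T.PiX) = γ₁ (x.right : T.PiX))
    (h₂ : ∀ x : T.env, ((e x).right : T.PiX) = γ₂ (x.right : T.PiX)) : γ₁ = γ₂ := by
  apply ContinuousMulEquiv.ext
  intro g
  refine eq_of_conj_eq hslim fun p => ?_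
  let x : T.env := e.symm (CycEnvelope.algSection T.augY T.chi p)
  have hp : ((e x).right : T.PiX) = p := by
    simp only [x, MulEquiv.apply_symm_apply, SemidirectProduct.right_inr]
  have key : ∀ γ : T.PiX ≃ₜ* T.PiX, (∀ x : T.env, ((e x).right : T.PiX) = γ (x.right : T.PiX)) →
      γ g * (p : T.PiX) * (γ g)⁻¹ = ((e (T.conjX g x)).right : T.PiX) := fun γ hγ => by
    rw [hγ, T.right_conjX, map_mul, map_mul, map_inv, ← hγ x, hp]
  rw [key γ₁ h₁, key γ₂ h₂]

/-! ## Finiteness of the automorphisms over `id_{Π^tp_Y}` (Cor 2.18 (iv), fibres) -/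

/-- `Π^tp_Ÿ ⊊ Π^tp_Y` (index `2`). [cite: MochizukiEtTh2009, Def 2.13 p.47] -/
theorem exists_not_mem_PiYdd : ∃ g₀ : T.PiY, g₀ ∉ T.PiYdd.subgroupOf T.PiY := by
  by_contra h
  simp only [not_exists, not_not] at h
  have : T.PiYdd.subgroupOf T.PiY = ⊤ := top_le_iff.mp fun g _ => h g
  have h2 := T.index_PiYdd
  rw [this, Subgroup.index_top] at h2
  exact absurd h2 (by norm_num)

/-- A homomorphism `Π^tp_Y → μ_N` killing `Π^tp_Ÿ` is determined by one value off `Π^tp_Ÿ`.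
[cite: MochizukiEtTh2009, Cor 2.18(iv) p.63] -/
theorem hom_eq_of_apply_eq {φ₁ φ₂ : T.PiY →* T.mu} (h₁ : ∀ d : T.PiYdd, φ₁ (T.inclYdd d) = 1)
    (h₂ : ∀ d : T.PiYdd, φ₂ (T.inclYdd d) = 1) {g₀ : T.PiY}
    (hg₀ : g₀ ∉ T.PiYdd.subgroupOf T.PiY) (h : φ₁ g₀ = φ₂ g₀) : φ₁ = φ₂ := by
  have hkill : ∀ (φ : T.PiY →* T.mu), (∀ d : T.PiYdd, φ (T.inclYdd d) = 1) →
      ∀ k : T.PiY, k ∈ T.PiYdd.subgroupOf T.PiY → φ k = 1 := fun φ hφ k hk =>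
    hφ ⟨k, Subgroup.mem_subgroupOf.mp hk⟩
  ext k
  by_cases hk : k ∈ T.PiYdd.subgroupOf T.PiY
  · rw [hkill φ₁ h₁ k hk, hkill φ₂ h₂ k hk]
  · have hmem : g₀⁻¹ * k ∈ T.PiYdd.subgroupOf T.PiY := by
      rw [Subgroup.mul_mem_iff_of_index_two T.index_PiYdd, Subgroup.inv_mem_iff]
      exact ⟨fun h' => absurd h' hg₀, fun h' => absurd h' hk⟩
    have hk' : k = g₀ * (g₀⁻¹ * k) := by group
    have e1 : φ₁ k = φ₁ g₀ * φ₁ (g₀⁻¹ * k) := by rw [← map_mul, ← hk']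
    have e2 : φ₂ k = φ₂ g₀ * φ₂ (g₀⁻¹ * k) := by rw [← map_mul, ← hk']
    rw [e1, e2, hkill φ₁ h₁ _ hmem, hkill φ₂ h₂ _ hmem, h]

/-- `Hom(Π^tp_Y/Π^tp_Ÿ, μ_N)` is finite. [cite: MochizukiEtTh2009, Cor 2.18(iv) p.63] -/
theorem finite_homKill :
    Set.Finite {φ : T.PiY →* T.mu | ∀ d : T.PiYdd, φ (T.inclYdd d) = 1} := by
  obtain ⟨g₀, hg₀⟩ := T.exists_not_mem_PiYdd
  refine Set.Finite.of_finite_image (f := fun φ : T.PiY →* T.mu => φ g₀) (Set.toFinite _) ?_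
  intro φ₁ h₁ φ₂ h₂ h
  exact T.hom_eq_of_apply_eq h₁ h₂ hg₀ h

/-- **Finiteness of the automorphisms of `M(η)` over `id_{Π^tp_Y}`**, given the fibre description
of Cor 2.18 (iv) (`μ_N`-conjugates of the twists by `Hom(Π•_Y/Π•_Ÿ, Ker(Π• ↠ Π•_Y))`, a group of
cardinality `≤ 2`, p.63). [cite: MochizukiEtTh2009, Cor 2.18(iv) p.63] -/
theorem finite_autOverId
    (hfib : ∀ α : (T.modelMono hη).Iso (T.modelMono hη),
      (∀ x, CycEnvelope.proj T.augY T.chi (α.e x) = CycEnvelope.proj T.augY T.chi x) →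
      ∃ (φ : T.PiY →* T.mu) (_ : ∀ g : T.PiYdd, φ (T.inclYdd g) = 1) (c : T.mu),
        ∀ x : T.env, α.e x = MulAut.conj (CycEnvelope.inMu T.augY T.chi c)
          (CycEnvelope.inMu T.augY T.chi (φ (CycEnvelope.proj T.augY T.chi x)) * x)) :
    Set.Finite {e : MulAut T.env | (∃ β : (T.modelMono hη).Iso (T.modelMono hη), ∀ x, β.e x = e x) ∧
      ∀ x, (e x).right = x.right} := by
  let f : T.mu × (T.PiY →* T.mu) → (T.env → T.env) := fun q x =>
    MulAut.conj (CycEnvelope.inMu T.augY T.chi q.1)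
      (CycEnvelope.inMu T.augY T.chi (q.2 (CycEnvelope.proj T.augY T.chi x)) * x)
  have hS : Set.Finite (f '' (Set.univ ×ˢ {φ : T.PiY →* T.mu | ∀ d : T.PiYdd, φ (T.inclYdd d) = 1})) :=
    (Set.finite_univ.prod T.finite_homKill).image f
  refine Set.Finite.of_finite_image (f := fun e : MulAut T.env => (e : T.env → T.env))
    (hS.subset ?_) fun e₁ _ e₂ _ h => MulEquiv.ext fun x => congrFun h x
  rintro _ ⟨e, ⟨⟨β, hβ⟩, he⟩, rfl⟩
  obtain ⟨φ, hφ, c, hc⟩ := hfib β fun x => by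
    change (β.e x).right = x.right
    rw [hβ]; exact he x
  refine ⟨(c, φ), ⟨Set.mem_univ _, hφ⟩, funext fun x => ?_⟩
  change _ = e x
  rw [← hβ, hc]

end ThetaEnvData

/-! ## Reductions `Π^tp_Y[μ_{M'}] ↠ Π^tp_Y[μ_M]` -/

namespace ThetaEnvTower

variable {E : Set ℕ+} (T : ThetaEnvTower.{u} E)

/-- The reduction is the identity on `Π^tp_Y`. [cite: MochizukiEtTh2009, Def 2.13(ii) p.48] -/
theorem right_redEnv (M M' : E) (h : (M : ℕ+) ∣ M') (x : (T.level M').env) :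
    (T.redEnv M M' h x).right = x.right := rfl

/-- The reduction on the cyclotome. [cite: MochizukiEtTh2009, Def 2.13(ii) p.48] -/
theorem left_redEnv (M M' : E) (h : (M : ℕ+) ∣ M') (x : (T.level M').env) :
    (T.redEnv M M' h x).left = T.red M M' h x.left := rfl

/-- The reduction is surjective (`μ_{M'} ↠ μ_M`). [cite: MochizukiEtTh2009, Def 2.13(ii) p.48] -/
theorem redEnv_surjective (M M' : E) (h : (M : ℕ+) ∣ M') :
    Function.Surjective (T.redEnv M M' h) := by
  intro y
  obtain ⟨a, ha⟩ := T.red_surjective M M' h y.left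
  exact ⟨⟨a, y.right⟩, by ext <;> simp [left_redEnv, right_redEnv, ha]⟩

/-- `red_{M,M} = id`. [cite: MochizukiEtTh2009, Def 2.13(ii) p.48] -/
theorem redEnv_self (M : E) (h : (M : ℕ+) ∣ M) (x : (T.level M).env) : T.redEnv M M h x = x := by
  ext
  · exact T.red_self M h x.left
  · rfl

/-- `red_{M'',M} = red_{M',M} ∘ red_{M'',M'}`. [cite: MochizukiEtTh2009, Def 2.13(ii) p.48] -/
theorem redEnv_comp (M M' M'' : E) (h : (M : ℕ+) ∣ M') (h' : (M' : ℕ+) ∣ M'')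
    (x : (T.level M'').env) :
    T.redEnv M M'' (h.trans h') x = T.redEnv M M' h (T.redEnv M' M'' h' x) := by
  ext
  · exact T.red_comp M M' M'' h h' x.left
  · rfl

variable {T}

/-- The reduced automorphism is unique. [cite: MochizukiEtTh2009, Cor 2.18(iv) p.61] -/
theorem reduces_unique {M M' : E} {h : (M : ℕ+) ∣ M'} {α' : MulAut (T.level M').env}
    {α₁ α₂ : MulAut (T.level M).env} (h₁ : T.Reduces h α' α₁) (h₂ : T.Reduces h α' α₂) :
    α₁ = α₂ := by
  apply MulEquiv.ext
  intro y
  obtain ⟨x, rfl⟩ := T.redEnv_surjective M M' h y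
  rw [← h₁ x, ← h₂ x]

/-- `Reduces` is multiplicative. [cite: MochizukiEtTh2009, Cor 2.18(iv) p.61] -/
theorem reduces_mul {M M' : E} {h : (M : ℕ+) ∣ M'} {α' β' : MulAut (T.level M').env}
    {α β : MulAut (T.level M).env} (hα : T.Reduces h α' α) (hβ : T.Reduces h β' β) :
    T.Reduces h (α' * β') (α * β) := fun x => by
  rw [MulAut.mul_apply, MulAut.mul_apply, hα, hβ]

/-- `Reduces` passes to inverses. [cite: MochizukiEtTh2009, Cor 2.18(iv) p.61] -/
theorem reduces_inv {M M' : E} {h : (M : ℕ+) ∣ M'} {α' : MulAut (T.level M').env}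
    {α : MulAut (T.level M).env} (hα : T.Reduces h α' α) : T.Reduces h α'⁻¹ α⁻¹ := fun x => by
  apply α.injective
  rw [← MulAut.mul_apply, mul_inv_cancel, MulAut.one_apply, ← hα, ← MulAut.mul_apply,
    mul_inv_cancel, MulAut.one_apply]

/-- `1` reduces to `1`. [cite: MochizukiEtTh2009, Cor 2.18(iv) p.61] -/
theorem reduces_one {M M' : E} {h : (M : ℕ+) ∣ M'} : T.Reduces h (1 : MulAut (T.level M').env) 1 :=
  fun _ => rfl

/-- `Reduces` is transitive along `M ∣ M' ∣ M''`. [cite: MochizukiEtTh2009, Cor 2.18(iv) p.61] -/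
theorem reduces_comp {M M' M'' : E} {h : (M : ℕ+) ∣ M'} {h' : (M' : ℕ+) ∣ M''}
    {α'' : MulAut (T.level M'').env} {α' : MulAut (T.level M').env} {α : MulAut (T.level M).env}
    (h₁ : T.Reduces h' α'' α') (h₂ : T.Reduces h α' α) : T.Reduces (h.trans h') α'' α := fun x => by
  rw [T.redEnv_comp M M' M'' h h', h₁, h₂, ← T.redEnv_comp]

/-- Along `M ∣ M` every automorphism reduces to itself. [cite: MochizukiEtTh2009, Cor 2.18(iv) p.61] -/
theorem reduces_self {M : E} {h : (M : ℕ+) ∣ M} (α : MulAut (T.level M).env) : T.Reduces h α α :=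
  fun x => by rw [T.redEnv_self, T.redEnv_self]

/-- `μ_{M'}`-conjugation reduces to `μ_M`-conjugation. [cite: MochizukiEtTh2009, Cor 2.18(iv) p.61] -/
theorem reduces_conj_inMu {M M' : E} {h : (M : ℕ+) ∣ M'} (c : T.mu M') :
    T.Reduces h (MulAut.conj (CycEnvelope.inMu (T.level M').augY (T.chi M') c))
      (MulAut.conj (CycEnvelope.inMu (T.level M).augY (T.chi M) (T.red M M' h c))) := fun x => by
  have hc : T.redEnv M M' h (CycEnvelope.inMu (T.level M').augY (T.chi M') c) =
      CycEnvelope.inMu (T.level M).augY (T.chi M) (T.red M M' h c) := by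
    ext <;> rfl
  rw [MulAut.conj_apply, MulAut.conj_apply, map_mul, map_mul, map_inv, hc]

/-- A reduced automorphism lies over the same map on `Π^tp_Y` (hence over the same automorphism of
`Π^tp_X`). [cite: MochizukiEtTh2009, Cor 2.18(iv) p.61] -/
theorem right_eq_of_reduces {M M' : E} {h : (M : ℕ+) ∣ M'} {α' : MulAut (T.level M').env}
    {α : MulAut (T.level M).env} (hα : T.Reduces h α' α) {γ : T.PiX → T.PiX}
    (hγ : ∀ x, ((α' x).right : T.PiX) = γ (x.right : T.PiX)) (y : (T.level M).env) :
    ((α y).right : T.PiX) = γ (y.right : T.PiX) := by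
  obtain ⟨x, rfl⟩ := T.redEnv_surjective M M' h y
  rw [← hα x, right_redEnv, right_redEnv, hγ]

/-- Model environments at one level attached to EQUAL cocycles (with possibly different membership
witnesses) have the same isomorphisms. [cite: MochizukiEtTh2009, Def 2.13(ii) p.47] -/
theorem exists_iso_congr {M : E} {η₁ η₂ : T.PiYdd → T.mu M} (h : η₁ = η₂)
    (h₁ : η₁ ∈ T.thetaCocycles M) (h₂ : η₂ ∈ T.thetaCocycles M)
    (α : ((T.level M).modelMono h₁).Iso ((T.level M).modelMono h₁)) :
    ∃ β : ((T.level M).modelMono h₂).Iso ((T.level M).modelMono h₂),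
      β.e.toMulEquiv = α.e.toMulEquiv := by
  subst h
  exact ⟨α, rfl⟩

end ThetaEnvTower

end Literature.AnabelianGeometry.EtaleTheta
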